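import Summits.BirchSwinnertonDyer.BirchSwinnertonDyer.Theses.SignedLowerHalves
import Summits.BirchSwinnertonDyer.BirchSwinnertonDyer.Theorems.SignedLowerHalvesSprungLowerDivisibilityAtThreeRankCut
import Summits.BirchSwinnertonDyer.BirchSwinnertonDyer.Theorems.SignedLowerHalvesSprungLowerHalfAtThreeKDotSplitReal
import Summits.BirchSwinnertonDyer.BirchSwinnertonDyer.Theorems.SprungSharpFlatMainConjecture
import Summits.BirchSwinnertonDyer.Rank1Residual.Supersingular.KobayashiEquivalenceRankZero
import Summits.BirchSwinnertonDyer.Rank1Residual.Supersingular.KobayashiMainConjecture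
import Literature.NumberTheory.EllipticCurves.Rank1Residual.Typed.X7
import Literature.NumberTheory.EllipticCurves.KuriharaNumberInvariants
import Literature.NumberTheory.EllipticCurves.Tamagawa
import Literature.NumberTheory.EllipticCurves.Sprung2012.SharpFlatKatoDivisibility
import Literature.NumberTheory.EllipticCurves.CyclotomicZpExtensionLocalGeneratorProofs
import Literature.NumberTheory.EllipticCurves.Sprung2017.SharpFlatNonvanishingProofs
import Literature.NumberTheory.EllipticCurves.Sprung2017.SharpFlatPAdicLFunctionProofs
import Literature.NumberTheory.EllipticCurves.Sprung2024.ChromaticCharValueRankZeroAllN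
import Literature.NumberTheory.EllipticCurves.ModularCurve
import Literature.NumberTheory.EllipticCurves.ModularCurveNeronLatticeProofs
import Literature.NumberTheory.EllipticCurves.ModularParametrizationDegreeHoldsProofs
import Literature.NumberTheory.EllipticCurves.ModularCurveManinSemistableLatticeFormProofs
import Literature.NumberTheory.EllipticCurves.LeadingTermPPartProofs
import Literature.NumberTheory.EllipticCurves.CuspFormLFunctionAnalyticRankProofs
import Literature.NumberTheory.EllipticCurves.AnalyticRankOrderProofs
import Summits.BirchSwinnertonDyer.BirchSwinnertonDyer.Theorems.SignedLowerHalvesSprungLowerDivisibilityAtThreeControlAtT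
import HarnessLib

/-!
# Route `SignedLowerHalves` (rung K3, leaf `SignedSupersingular`), crux 5 `SprungLowerHalfAtThree` (item stmt-BirchSwinnertonDyer-19003) and its
# children K1 `SprungLowerDivisibilityAtThree` (19875) / K2 `SharpFlatRankZeroConverseAtThree` (19877): THE RANK CUT OF CRUX 5 FOR THE LEAF —
# the leaf consumes crux 5 only at the X8 pairs with `r_an = 0` (and `ρ̄_{E,3}` onto), where K2 is automatic and K1 is needed at `r_an = 0`
# only; kernel pieces of the pen's turnkey #4 `K3-route/rankcut-crux5-g34` (D34-8: «any prover may land that variant now — pure re-threading»)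

Cell `bsd-ssimc` (host), width seat `cruxlead-stmt-BirchSwinnertonDyer-19875-w2` (g3) under the 19875 lead; `--supports` 19003 `--as helper`;
theorems only; closes NO item and executes NO route verb (rev 16 stands; D34-7 (1) NO-RESTATE); registry of 19875 unchanged (skeleton v8).
Companions: `…SprungLowerDivisibilityAtThreeRankCut` (p620968, per pair), `…SprungLowerHalfAtThreeRankZeroGlue` (p621820, crux 5 ⟸ K1-at-r_an-0 ∧ K2
∧ K3 ∧ S4), `…KobayashiLowerHalfLargeImageRankCut` (p617986, slh-p1 LEAD g3: the same cut for crux 3). The leaf, crux 5, K1, K2, BSD are NOT proved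
by anything here.

## What is proved

The K3 bridge `SignedSupersingular.signedSupersingular_of_lowerHalves` (p405667; re-run with crux 3 cut in p617986) applies crux 5 (`hB3`) in
exactly one place: corner X8 with `W.analyticRank = 0 ∧ Surj W p` (`X8.missingInputAt_of_chromaticLowerDivisibility_of_surj`); elsewhere on
X8 it uses the residual item `SharpFlatResiduePPart` (R8). And crux 5's glue (item 19880) needs, at a pair with finite `Sel_{3^∞}(E/ℚ)`, the
value `L(E,1) ≠ 0` — supplied by K2 in general, but AUTOMATIC at `r_an = 0` (the newform of S4(M) gives the entire continuation,
`IsNewformOf.hasEntireLFunction`; `analyticRank_eq_zero_iff_holds`). Hence: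

* §1 `sprungLowerHalfAtThree_analyticRank_eq_zero_of_lowerDivisibility` — **crux 5's body at every X8 pair with `r_an = 0` ⟸ «K1's
  predicate at the X8 pairs with `r_an = 0`» ∧ K3 `SharpFlatCharValueRankZeroAllLevels` ∧ S4 `SharpFlatPublishedInputsAtThree`** — NO K2.
* §2 `signedSupersingular_of_lowerHalves_rankCuts` — **the leaf `SignedSupersingular` ⟸ `KobayashiLowerHalfSemistable` ∧ (crux 3 at
  `r_an ≤ 1`) ∧ `KobayashiMainConjectureSmallImage` ∧ (crux 5's body at the X8 pairs with `r_an = 0` and `ρ̄_{E,3}` onto) ∧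
  `SharpFlatResiduePPart` ∧ `PublishedSignedInputs`** (the bridge re-run with both cruxes fed the leaf's own bounds; the six route items
  re-assemble through the cuts exactly as in `LargeImageRankCut.signedSupersingular_of_items_via_rankCut`, p617986).
* §3 `signedSupersingular_of_katoSporadic_of_posLevel` — the composition with p620968 §3: **the leaf ⟸ B1 ∧ (crux 3 at `r_an ≤ 1`) ∧ B2′ ∧ R8 ∧
  PublishedSignedInputs ∧ K3 ∧ S4 ∧ hKsp ∧ hCyc ∧ h714 ∧ h3 ∧ hJ** (`hKsp` = K_spor, `hCyc` = S4b-cyc of 19875's skeleton v8, VERBATIM).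

READING (calibration for DOSSIER-19875 §1 / turnkey #4; nothing restated): in the LEAF's cone the X8 branch needs neither K1 at `r_an ≥ 1`, nor
K2 = item 19877 (the rank-`0` `3`-converse at `a₃ = ±3`, OPEN) at all, nor the v8 stub S4b-T, nor `hGZK`/`hKob` for K1: what it needs behind
crux 5 is exactly {Kato 12.10 at the sporadic common zeros, Sprung 7.21 at the positive-level cyclotomic common zeros} at the X8 pairs with
`r_an = 0` and surjective `ρ̄_{E,3}`, plus the held inputs h714 / h3 / hJ (W-β), K3 (19878) and S4 (19929). The r_an ≥ 1 and small-image X8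
pairs of the leaf are R8's (`SharpFlatResiduePPart`), untouched here.

References: [Sprung2012] Thm. 2.2, Thm. 7.14, Prop. 6.14, Main Conj. 7.21; [Sprung2024] §5.2 Lemmas 5.5–5.9; [Kato2004Asterisque] Conj. 12.10 (p. 224);
[Kobayashi2003] Thm. 1.2, Thm. 4.1; [BurungaleKobayashiOta2023] Cor. A.5; [Miller2011LMS] Def. 1.1; [BirchSwinnertonDyer1965]; [DiamondShurman2005] Thm. 5.10.2;
tree: `SignedSupersingular.signedSupersingular_of_lowerHalves` (p405667), `…KobayashiLowerHalfLargeImageRankCut` (p617986), `SprungLowerHalfAtThreeSplit` (19880),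
`…SprungLowerDivisibilityAtThreeRankCut` (p620968), `…SprungLowerHalfAtThreeRankZeroGlue` (p621820).
-/

set_option linter.dupNamespace false
set_option autoImplicit false

noncomputable section

open scoped Classical NumberField MatrixGroups ModularForm

open NumberField IsDedekindDomain CongruenceSubgroup WeierstrassCurve Field
  Literature.NumberTheory.EllipticCurves Literature.NumberTheory.EllipticCurves.ModularForms
  Literature.NumberTheory.EllipticCurves.ZpExtension Literature.NumberTheory.EllipticCurves.Sprung2017
  Literature.NumberTheory.EllipticCurves.Sprung2012 Literature.NumberTheory.EllipticCurves.Rank1Residual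
  Literature.NumberTheory.EllipticCurves.Rank1Residual.Typed
  Literature.NumberTheory.EllipticCurves.IwasawaAlgebra Literature.NumberTheory.EllipticCurves.Kato2004
  Summit.BirchSwinnertonDyer.BirchSwinnertonDyer.Theorems
  Summit.BirchSwinnertonDyer.Rank1Residual.Supersingular
  Summit.BirchSwinnertonDyer.BirchSwinnertonDyer.Theses.SignedLowerHalves

namespace Summit.BirchSwinnertonDyer.BirchSwinnertonDyer.Theorems.ChromaticCommonZeros

/-! ### §1 Crux 5 at analytic rank zero needs no K2 -/

/-- **Crux 5's body at every X8 pair with `r_an = 0`, from «K1's predicate at the X8 pairs with `r_an = 0`» ∧ K3 ∧ S4 — WITHOUT K2.** The glue of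
item 19880 (re-run in p621820 §1) with the appeal to K2 `SharpFlatRankZeroConverseAtThree` replaced by the hypothesis `r_an = 0` itself:
`L(E,1) ≠ 0` by `analyticRank_eq_zero_iff_holds` on the entire continuation of the newform's `L`-function (`IsNewformOf.hasEntireLFunction`,
S4(M)). Positive corank ⇒ `ξ = h = 0` (`chromaticDatum_of_not_finite_selmer`); else a colour with `L^• ≠ 0` (Prop. 6.14), the real dual datum,
K1 at THIS pair, cotorsion (S4(T)), Kim's unit (K3). CONDITIONAL (displayed); closes nothing.
[cite: Sprung2012, Thm. 2.2, Thm. 1.2, Prop. 6.14 and Main Conj. 7.21] [cite: Sprung2024, §5.2 Lemmas 5.5–5.9] [cite: BirchSwinnertonDyer1965]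
[cite: DiamondShurman2005, Thm. 5.10.2 and §8.8] -/
theorem sprungLowerHalfAtThree_analyticRank_eq_zero_of_lowerDivisibility
    (hK1z : ∀ (W : WeierstrassCurve ℚ) [W.IsElliptic] [W.IsGloballyMinimal] (p : ℕ) [Fact p.Prime],
      ClassX8 W p → W.analyticRank = 0 → ∀ col : Chroma, SprungSharpFlatLowerDivisibility W p col)
    (hK3 : SharpFlatCharValueRankZeroAllLevels) (hS4 : SharpFlatPublishedInputsAtThree) :
    ∀ (W : WeierstrassCurve ℚ) [W.IsElliptic] [W.IsGloballyMinimal] (p : ℕ) [Fact p.Prime], ClassX8 W p → W.analyticRank = 0 →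
      ∃ (N : ℕ) (_ : NeZero N) (f : CuspForm (CongruenceSubgroup.Gamma0 N) 2) (ϖ : ℚ) (Lsharp Lflat : IwasawaAlgebra p)
        (c : Chroma) (ξ : IwasawaAlgebra p), IsNewformOf W f ∧ (ϖ : ℝ) * W.realPeriodRat = plusPeriod f ∧
        IsSprungPair f p (W.frobeniusTrace p) Lsharp Lflat ∧ (⟨ξ, 0, 0⟩ : SignedDatum W p).EulerCharacteristic ∧
        ∃ h : IwasawaAlgebra p, iwasawaToPowerSeries p ξ =
          PowerSeries.C (ϖ : ℚ_[p]) * iwasawaToPowerSeries p (chromaticL c Lsharp Lflat * h) := by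
  intro W _ _ p _ hX h0
  have hp3 : p = 3 := hX.1
  subst hp3
  have hp2 : (3 : ℕ) ≠ 2 := by decide
  have hgood : W.HasGoodReductionAtPrime 3 := hX.2.1.1
  have hdvd : ((3 : ℕ) : ℤ) ∣ W.frobeniusTrace 3 := hX.2.1.2
  -- S4(M): a newform `f` of `W`; the real objects `(f, ϖ, L♯, L♭)` (period ratio by the tree theorems behind
  -- `exists_pos_periodRatio_of_isNewformOf`, Sprung pair by Thm. 1.12)
  obtain ⟨⟨N, hN, f, hf⟩, hS4'⟩ := hS4 W 3 hX
  haveI := hN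
  haveI : (W.baseChange ℂ).IsElliptic := by rw [WeierstrassCurve.baseChange]; infer_instance
  obtain ⟨Lat, hLat⟩ := exists_isNeronLatticeOf_holds (W.baseChange ℂ)
  obtain ⟨cM, hcM0, hcM⟩ := IsNewformOf.exists_maninConstant_ne_zero_holds hf hLat
  obtain ⟨Dm, hDf, -, -⟩ := ModularParametrizationData.exists_of_isNewformOf hf hLat hcM0 hcM
  obtain ⟨ϖ, -, hϖ', -⟩ := Dm.exists_rat_mul_realPeriodRat_eq_plusPeriod
  have hϖ : (ϖ : ℝ) * W.realPeriodRat = plusPeriod f := by rw [hϖ', hDf]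
  obtain ⟨Lsharp, Lflat, hSP⟩ :=
    thm112_exists_isSprungPair_holds (W := W) (f := f) (p := 3) hp2 hf hgood hdvd
  suffices hB : ∃ (col : Chroma) (ξ : IwasawaAlgebra 3),
      (⟨ξ, 0, 0⟩ : SignedDatum W 3).EulerCharacteristic ∧
        ∃ h : IwasawaAlgebra 3, iwasawaToPowerSeries 3 ξ =
          PowerSeries.C (ϖ : ℚ_[3]) * iwasawaToPowerSeries 3 (chromaticL col Lsharp Lflat * h) by
    obtain ⟨col, ξ, hK, hdiv⟩ := hB
    exact ⟨N, hN, f, ϖ, Lsharp, Lflat, col, ξ, hf, hϖ, hSP, hK, hdiv⟩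
  -- positive corank: `ξ = h = 0` — K1 is not used
  by_cases hfin : Finite (W.selmerGroupPInfty 3)
  swap
  · exact ⟨.flat, chromaticDatum_of_not_finite_selmer W 3 hfin ϖ (chromaticL .flat Lsharp Lflat)⟩
  -- `L(E,1) ≠ 0` from `r_an = 0` on the entire continuation of `L(f, s) = L(W, s)` — NO K2
  have hL : W.entireLFunction 1 ≠ 0 := (W.analyticRank_eq_zero_iff_holds hf.hasEntireLFunction).1 h0
  obtain ⟨κ, hκ, γ, hγ, hγ'⟩ := exists_isCyclotomic_isTopGenerator_isCyclotomicVariable_holds 3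
  obtain ⟨v, hv⟩ :=
    Literature.NumberTheory.NumberFields.RingOfIntegers.exists_heightOneSpectrum_natCast_mem ℚ
      (p := 3) (by norm_num)
  obtain ⟨g, hg⟩ := hκ.exists_isTopGenerator_resGalOfEmb_adicCompletion v hv
  obtain ⟨⟨cneg, c, hc⟩, h714⟩ := hS4' κ γ hκ hγ hγ' v hv g hg
  obtain ⟨col, hcol⟩ := hSP.exists_chromaticL_ne_zero hf hgood
  let D := sharpFlatSelmerDualData W κ (closureEmb (K := ℚ) (v.adicCompletion ℚ))
    (W.frobeniusTrace 3) g c col hγ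
  -- K1 AT THIS RANK-ZERO PAIR ONLY
  obtain ⟨gen, h, hchar, hι⟩ :=
    hK1z W 3 hX h0 col κ γ hκ hγ hγ' v hv g hg cneg c hc N hN f ϖ Lsharp Lflat hf hϖ hSP hcol D
  obtain ⟨hfinD, htorD⟩ := h714 cneg c hc N hN f hf col Lsharp Lflat hSP hcol D
  haveI := hfinD
  obtain ⟨u, hu⟩ :=
    hK3 W 3 hp2 hgood hdvd hL κ γ hκ hγ hγ' v hv g hg cneg c hc col D htorD gen hchar hfin
  exact ⟨col, gen, fun _ => ⟨u, hu⟩, h, hι⟩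

/-! ### §2 The leaf with both supersingular cruxes cut to the ranks it uses -/

/-- **Rung K3's leaf `SignedSupersingular` with crux 3 cut to `r_an ≤ 1` AND crux 5 cut to the X8 pairs with `r_an = 0` and `ρ̄_{E,3}` onto.**
Verbatim the bridge `SignedSupersingular.signedSupersingular_of_lowerHalves` (p405667) as re-run in `LargeImageRankCut` (p617986), with the ONE
further change that crux 5 (`hB3`) is fed the branch hypotheses `r_an = 0`, `Surj W p` under which the bridge applies it
(`X8.missingInputAt_of_chromaticLowerDivisibility_of_surj`); all other X8 pairs of the leaf go through R8 `SharpFlatResiduePPart`.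
CONDITIONAL bookkeeping; closes nothing. [cite: Kobayashi2003, Thm. 1.2, Thm. 4.1 and Conjecture (p. 2)] [cite: Miller2011LMS, Def. 1.1]
[cite: Sprung2012, Main Conj. 7.21 (p. 1505)] -/
theorem signedSupersingular_of_lowerHalves_rankCuts
    (hB1 : KobayashiLowerHalfSemistable)
    (hB2 : ∀ (W : WeierstrassCurve ℚ) [W.IsElliptic] [W.IsGloballyMinimal] (p : ℕ) [Fact p.Prime],
      p ≠ 2 → ClassX7 W p → ¬ W.HasCM → W.frobeniusTrace p = 0 → Surj W p → W.analyticRank ≤ 1 →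
      ∃ ε : ℤˣ, KobayashiLowerDivisibility W p ε)
    (hB2' : KobayashiMainConjectureSmallImage)
    (hB3 : ∀ (W : WeierstrassCurve ℚ) [W.IsElliptic] [W.IsGloballyMinimal] (p : ℕ) [Fact p.Prime], ClassX8 W p →
      W.analyticRank = 0 → Surj W p →
      ∃ (N : ℕ) (_ : NeZero N) (f : CuspForm (CongruenceSubgroup.Gamma0 N) 2) (ϖ : ℚ) (Lsharp Lflat : IwasawaAlgebra p)
        (c : Chroma) (ξ : IwasawaAlgebra p), IsNewformOf W f ∧ (ϖ : ℝ) * W.realPeriodRat = plusPeriod f ∧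
        IsSprungPair f p (W.frobeniusTrace p) Lsharp Lflat ∧ (⟨ξ, 0, 0⟩ : SignedDatum W p).EulerCharacteristic ∧
        ∃ h : IwasawaAlgebra p, iwasawaToPowerSeries p ξ =
          PowerSeries.C (ϖ : ℚ_[p]) * iwasawaToPowerSeries p (chromaticL c Lsharp Lflat * h))
    (hR8 : SharpFlatResiduePPart) (hPub : PublishedSignedInputs) :
    Summit.BirchSwinnertonDyer.Rank1Residual.Supersingular.SignedSupersingular := by
  unfold KobayashiLowerHalfSemistable at hB1
  unfold KobayashiMainConjectureSmallImage at hB2'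
  unfold SharpFlatResiduePPart at hR8
  unfold PublishedSignedInputs at hPub
  intro W _ _ p _ hr hcm hp
  obtain ⟨hW, h12, h41, hKim, hA5, h5, h3, hmodP, hmod, hGZK⟩ := hPub
  haveI : Finite W.sha := (hGZK W hr).2
  have hPP := fun h ↦ Literature.NumberTheory.EllipticCurves.Rank1Residual.Typed.missingPPartAt_of_bsdp W p h
  have hLU := fun h ↦
    Literature.NumberTheory.EllipticCurves.Rank1Residual.Typed.lower_and_upper_of_missingPPartAt W p h
  have toX6 : Literature.NumberTheory.EllipticCurves.Rank1Residual.Typed.MissingPPartAt W p →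
      Literature.NumberTheory.EllipticCurves.Rank1Residual.Typed.X6.MissingInputAt W p := fun h ↦
    ⟨fun _ _ _ ↦ (hLU h).1, fun _ ↦ h⟩
  have toX7 : Literature.NumberTheory.EllipticCurves.Rank1Residual.Typed.MissingPPartAt W p →
      Literature.NumberTheory.EllipticCurves.Rank1Residual.Typed.X7.MissingInputAt W p := fun h ↦
    ⟨fun _ _ _ ↦ (hLU h).1, fun _ ↦ h⟩
  have toX8 : Literature.NumberTheory.EllipticCurves.Rank1Residual.Typed.MissingPPartAt W p →
      Literature.NumberTheory.EllipticCurves.Rank1Residual.Typed.X8.MissingInputAt W p := fun h ↦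
    ⟨fun _ _ ↦ (hLU h).1, fun _ ↦ h⟩
  -- corner X8 (used twice: directly, and for the `a_3 = ±3` pairs of corner X7 at `p = 3`)
  have hX8 : Literature.NumberTheory.EllipticCurves.Rank1Residual.ClassX8 W p →
      Literature.NumberTheory.EllipticCurves.Rank1Residual.Typed.X8.MissingInputAt W p := by
    intro hX
    by_cases hc : W.analyticRank = 0 ∧ Literature.NumberTheory.EllipticCurves.Rank1Residual.Surj W p
    · -- THE CHANGE w.r.t. the bridge: crux 5 is fed the branch hypotheses `r_an = 0`, `Surj W p`
      obtain ⟨N, _, f, ϖ, Lsharp, Lflat, c, ξ, hf, hϖ, hSP, hK, hdiv⟩ := hB3 W p hX hc.1 hc.2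
      exact Summit.BirchSwinnertonDyer.Rank1Residual.Supersingular.X8.missingInputAt_of_chromaticLowerDivisibility_of_surj
        W p hGZK hmod hX hc.2 hc.1 hf hϖ hSP c ξ hK hdiv
    · exact toX8 (hR8 W p hX hr hc)
  refine ⟨fun hX _ ↦ ?_, fun hX ↦ ?_, hX8⟩
  · -- corner X6
    obtain ⟨ε, hlow⟩ := hB1 W p hp hX
    exact toX6 (hPP (Summit.BirchSwinnertonDyer.Rank1Residual.Supersingular.X6.bsdp_of_lowerDivisibility W p
      hW h12 h41 hKim hA5 h5 h3 hmodP hmod hGZK hp hX hr ε hlow))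
  · -- corner X7
    by_cases hap : W.frobeniusTrace p = 0
    · by_cases hs : Literature.NumberTheory.EllipticCurves.Rank1Residual.Surj W p
      · -- crux 3 fed the leaf's own bound `hr` (as in p617986)
        obtain ⟨ε, hlow⟩ := hB2 W p hp hX hcm hap hs hr
        exact toX7 (hPP (Summit.BirchSwinnertonDyer.Rank1Residual.Supersingular.X7.bsdp_of_lowerDivisibility_of_surj
          W p hW h12 h41 hKim hA5 h5 h3 hmodP hmod hGZK hp hX hap hs hr ε hlow))
      · obtain ⟨ε, hMC⟩ := hB2' W p hp hX hcm hap hs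
        rcases Nat.le_one_iff_eq_zero_or_eq_one.mp hr with h0 | h1
        · exact toX7 (hPP (Summit.BirchSwinnertonDyer.Rank1Residual.Supersingular.bsdp_of_kobayashiMainConjecture_of_analyticRank_eq_zero
            W p h12 hKim Literature.NumberTheory.EllipticCurves.pollack_exists_plusMinusPAdicLFunction_holds hmodP
            hmod hGZK hp hX.1.1 hap (Literature.NumberTheory.EllipticCurves.Rank1Residual.ClassX7.irr W p hp hX)
            h0 hMC))
        · exact toX7 (hPP (Summit.BirchSwinnertonDyer.Rank1Residual.Supersingular.X7.bsdp_of_kobayashiMainConjecture_of_corA5_of_analyticRank_eq_one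
            W p hA5 hmod hGZK hp hX hap h1 ε hMC))
    · -- `a_p ≠ 0` at a good supersingular prime forces `p = 3`, `a_3 = ±3`: the pair is in corner X8
      have hp3 : p = 3 := by
        by_contra h3'
        have hpr : p.Prime := Fact.out
        have h5p : 5 ≤ p := by
          have h2 := hpr.two_le
          have h4 : p ≠ 4 := by intro h4; rw [h4] at hpr; norm_num at hpr
          omega
        exact hap (Summit.BirchSwinnertonDyer.Rank1Residual.Supersingular.ClassX7.frobeniusTrace_eq_zero_of_five_le
          W p h5p hX)
      subst hp3
      have hX' : Literature.NumberTheory.EllipticCurves.Rank1Residual.ClassX8 W 3 := ⟨rfl, hX.1, hap⟩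
      obtain ⟨hlow8, hpp8⟩ := hX8 hX'
      exact ⟨fun h0 _ himg ↦ hlow8 h0 himg, fun hc ↦ hpp8 (fun hc' ↦ hc ⟨hc'.1, hp, hc'.2⟩)⟩

/-! ### §3 The leaf from K_spor, the positive-level part of S4b and the held inputs (crux 5's branch) -/

section RankCut


-- The registered v7 stub K_spor VERBATIM (as in p614828) and the positive-level part of S4b VERBATIM (the hypothesis `hCyc` of
-- the lead's split door p617801), as section hypotheses.
variable
  (hKsp :
    ∀ (W : WeierstrassCurve ℚ) [W.IsElliptic] [W.IsGloballyMinimal] (p : ℕ) [Fact p.Prime]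
      [ContinuousSMul ℤ_[p] (W.tateModule p)] [Module.Free ℤ_[p] (W.tateModule p)]
      [Module.Finite ℤ_[p] (W.tateModule p)],
      ClassX8 W p → ∀ (κ : ZpExtension ℚ p) (γ : Field.absoluteGaloisGroup ℚ),
      κ.IsCyclotomic → κ.IsTopGenerator γ → IsCyclotomicVariable p γ →
    ∀ (v : HeightOneSpectrum (𝓞 ℚ)), (p : 𝓞 ℚ) ∈ v.asIdeal →
    ∀ (g : Field.absoluteGaloisGroup (v.adicCompletion ℚ)),
      κ.IsTopGenerator (resGalOfEmb (closureEmb (K := ℚ) (v.adicCompletion ℚ)) g) →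
    ∀ (cneg : localPoints W (v.adicCompletion ℚ)) (c : ℕ → localPoints W (v.adicCompletion ℚ)),
      IsHondaSystem κ (closureEmb (K := ℚ) (v.adicCompletion ℚ)) W (W.frobeniusTrace p) g cneg c →
    ∀ (N : ℕ) (_ : NeZero N) (f : CuspForm (Gamma0 N) 2) (ϖ : ℚ) (Lsharp Lflat : IwasawaAlgebra p),
      IsNewformOf W f → (ϖ : ℝ) * W.realPeriodRat = plusPeriod f →
      IsSprungPair f p (W.frobeniusTrace p) Lsharp Lflat →
    ∀ (I : Kato2004.IwasawaH1Data W p κ γ)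
      (Cs : SharpFlatColemanKatoData W p f ϖ κ γ (closureEmb (K := ℚ) (v.adicCompletion ℚ))
        (W.frobeniusTrace p) g c Chroma.sharp I)
      (Cf : SharpFlatColemanKatoData W p f ϖ κ γ (closureEmb (K := ℚ) (v.adicCompletion ℚ))
        (W.frobeniusTrace p) g c Chroma.flat I),
      Cs.Z = Cf.Z →
    ∀ (Y : W.FineSelmerDualData κ γ) (𝔭 : PrimeSpectrum (IwasawaAlgebra p)), 𝔭.asIdeal.height = 1 →
      (p : IwasawaAlgebra p) ∉ 𝔭.asIdeal →
      (¬ ∃ n : ℕ, ((cyclotomicOmega p n).map (Int.castRingHom ℤ_[p]) : PowerSeries ℤ_[p]) ∈ 𝔭.asIdeal) →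
      (∀ (col' : Chroma) (G' : IwasawaAlgebra p),
        iwasawaToPowerSeries p G' =
          PowerSeries.C (ϖ : ℚ_[p]) * iwasawaToPowerSeries p (chromaticL col' Lsharp Lflat) →
        G' ∈ 𝔭.asIdeal) →
      Module.lengthAt (IwasawaAlgebra p) (I.H ⧸ Cs.Z) 𝔭 ≤ Module.lengthAt (IwasawaAlgebra p) Y.X 𝔭)
  (hCyc :
    ∀ (W : WeierstrassCurve ℚ) [W.IsElliptic] [W.IsGloballyMinimal] (p : ℕ) [Fact p.Prime]
      [ContinuousSMul ℤ_[p] (W.tateModule p)] [Module.Free ℤ_[p] (W.tateModule p)]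
      [Module.Finite ℤ_[p] (W.tateModule p)],
      ClassX8 W p → ∀ (col : Chroma) (κ : ZpExtension ℚ p) (γ : Field.absoluteGaloisGroup ℚ),
      κ.IsCyclotomic → κ.IsTopGenerator γ → IsCyclotomicVariable p γ →
    ∀ (v : HeightOneSpectrum (𝓞 ℚ)), (p : 𝓞 ℚ) ∈ v.asIdeal →
    ∀ (g : Field.absoluteGaloisGroup (v.adicCompletion ℚ)),
      κ.IsTopGenerator (resGalOfEmb (closureEmb (K := ℚ) (v.adicCompletion ℚ)) g) →
    ∀ (cneg : localPoints W (v.adicCompletion ℚ)) (c : ℕ → localPoints W (v.adicCompletion ℚ)),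
      IsHondaSystem κ (closureEmb (K := ℚ) (v.adicCompletion ℚ)) W (W.frobeniusTrace p) g cneg c →
    ∀ (N : ℕ) (_ : NeZero N) (f : CuspForm (Gamma0 N) 2) (ϖ : ℚ) (Lsharp Lflat : IwasawaAlgebra p),
      IsNewformOf W f → (ϖ : ℝ) * W.realPeriodRat = plusPeriod f →
      IsSprungPair f p (W.frobeniusTrace p) Lsharp Lflat → chromaticL col Lsharp Lflat ≠ 0 →
    ∀ (D : SharpFlatSelmerDualData W κ γ (closureEmb (K := ℚ) (v.adicCompletion ℚ))
        (W.frobeniusTrace p) g c col) [Module.Finite (IwasawaAlgebra p) D.X],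
      Module.IsTorsion (IwasawaAlgebra p) D.X →
    ∀ (G : IwasawaAlgebra p),
      iwasawaToPowerSeries p G =
        PowerSeries.C (ϖ : ℚ_[p]) * iwasawaToPowerSeries p (chromaticL col Lsharp Lflat) →
    ∀ (I : Kato2004.IwasawaH1Data W p κ γ)
      (Cs : SharpFlatColemanKatoData W p f ϖ κ γ (closureEmb (K := ℚ) (v.adicCompletion ℚ))
        (W.frobeniusTrace p) g c Chroma.sharp I)
      (Cf : SharpFlatColemanKatoData W p f ϖ κ γ (closureEmb (K := ℚ) (v.adicCompletion ℚ))
        (W.frobeniusTrace p) g c Chroma.flat I),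
      Cs.Z = Cf.Z →
    ∀ 𝔭 : PrimeSpectrum (IwasawaAlgebra p), 𝔭.asIdeal.height = 1 →
      (PowerSeries.X : IwasawaAlgebra p) ∉ 𝔭.asIdeal →
      (∃ j : ℕ, 1 ≤ j ∧
        ((((Polynomial.cyclotomic (p ^ j) ℤ).comp (Polynomial.X + 1)).map (Int.castRingHom ℤ_[p]) : Polynomial ℤ_[p]) :
          PowerSeries ℤ_[p]) ∈ 𝔭.asIdeal) →
      (∀ (col' : Chroma) (G' : IwasawaAlgebra p),
        iwasawaToPowerSeries p G' =
          PowerSeries.C (ϖ : ℚ_[p]) * iwasawaToPowerSeries p (chromaticL col' Lsharp Lflat) →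
        G' ∈ 𝔭.asIdeal) →
      Module.lengthAt (IwasawaAlgebra p) (IwasawaAlgebra p ⧸ Ideal.span {G}) 𝔭 ≤
        Module.lengthAt (IwasawaAlgebra p) D.X 𝔭)


include hKsp hCyc in
/-- **The leaf `SignedSupersingular` with crux 5's branch discharged down to 19875's two live stubs**: B1 ∧ (crux 3 at `r_an ≤ 1`) ∧ B2′ ∧ R8 ∧
`PublishedSignedInputs` ∧ K3 (19878) ∧ S4 (19929) ∧ `hKsp` (K_spor VERBATIM) ∧ `hCyc` (S4b-cyc VERBATIM) ∧ h714 ∧ h3 ∧ hJ ⟹ the leaf — §2 with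
crux 5's rank-zero body from §1 and K1-at-`r_an = 0` from p620968 §3 (`lowerDivisibility_analyticRank_eq_zero_of_katoSporadic_of_posLevel`).
In the leaf's cone: no K1 at `r_an ≥ 1`, no K2 (item 19877), no S4b-T, no hGZK/hKob for K1. CONDITIONAL (displayed); closes nothing; calibration
for turnkey #4 (pen D34-8). [cite: Kato2004Asterisque, Conj. 12.10 (p. 224)] [cite: Sprung2012, Main Conj. 7.21 (p. 1505), Thm. 7.14 (p. 1504)]
[cite: Kobayashi2003, Thm. 1.2, Thm. 4.1] [cite: Miller2011LMS, Def. 1.1] -/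
theorem signedSupersingular_of_katoSporadic_of_posLevel
    (h714 : thm714_sharpFlatSelmerDual_finite_torsion) (h3 : realPeriodRat_eq_unit_mul_plusPeriod_three)
    (hJ : thm714seq_sharpFlatColemanKato_zetaJoint)
    (hB1 : KobayashiLowerHalfSemistable)
    (hB2 : ∀ (W : WeierstrassCurve ℚ) [W.IsElliptic] [W.IsGloballyMinimal] (p : ℕ) [Fact p.Prime],
      p ≠ 2 → ClassX7 W p → ¬ W.HasCM → W.frobeniusTrace p = 0 → Surj W p → W.analyticRank ≤ 1 →
      ∃ ε : ℤˣ, KobayashiLowerDivisibility W p ε)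
    (hB2' : KobayashiMainConjectureSmallImage) (hK3 : SharpFlatCharValueRankZeroAllLevels) (hS4 : SharpFlatPublishedInputsAtThree)
    (hR8 : SharpFlatResiduePPart) (hPub : PublishedSignedInputs) :
    Summit.BirchSwinnertonDyer.Rank1Residual.Supersingular.SignedSupersingular :=
  signedSupersingular_of_lowerHalves_rankCuts hB1 hB2 hB2'
    (fun W _ _ p _ hX h0 _ ↦ sprungLowerHalfAtThree_analyticRank_eq_zero_of_lowerDivisibility
      (lowerDivisibility_analyticRank_eq_zero_of_katoSporadic_of_posLevel hKsp hCyc h714 h3 hJ) hK3 hS4 W p hX h0)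
    hR8 hPub

end RankCut

/-! ### §4 (appended) Crux 5 cut to analytic rank `≤ 1` — the pen's ADD-NOT-RESTATE item text — from K1 at analytic rank ZERO -/

/-- **«Crux 5 restricted to `W.analyticRank ≤ 1`» ⟸ «K1's predicate at the X8 pairs with `r_an = 0`» ∧ K3 ∧ S4 ∧ GZK.** At `r_an = 1`
Gross–Zagier–Kolyvagin makes `Sel_{3^∞}(E/ℚ)` infinite (`ChromaticCommonZerosControlAtT.not_finite_selmerGroupPInfty_of_analyticRank_eq_one`),
so the datum `ξ = h = 0` serves (`chromaticDatum_of_not_finite_selmer`) and K1 is NOT used; at `r_an = 0`, §1 (no K2). This is the by-name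
closer of the item text the K3 pen proposes for turnkey #4 (`SprungLowerHalfAtThreeRankLeOne` := crux 5's body behind `W.analyticRank ≤ 1 →`,
D34-8), needing K1 only at `r_an = 0` and no K2 (19877). CONDITIONAL (displayed); closes nothing.
[cite: Sprung2012, Thm. 2.2, Prop. 6.14 and Main Conj. 7.21] [cite: GrossZagier1986, Thm. (7.3)] [cite: Kolyvagin1990, Thm. A] -/
theorem sprungLowerHalfAtThree_analyticRank_le_one_of_lowerDivisibility
    (hK1z : ∀ (W : WeierstrassCurve ℚ) [W.IsElliptic] [W.IsGloballyMinimal] (p : ℕ) [Fact p.Prime],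
      ClassX8 W p → W.analyticRank = 0 → ∀ col : Chroma, SprungSharpFlatLowerDivisibility W p col)
    (hK3 : SharpFlatCharValueRankZeroAllLevels) (hS4 : SharpFlatPublishedInputsAtThree)
    (hGZK : rank_eq_analyticRank_of_analyticRank_le_one) :
    ∀ (W : WeierstrassCurve ℚ) [W.IsElliptic] [W.IsGloballyMinimal] (p : ℕ) [Fact p.Prime], ClassX8 W p → W.analyticRank ≤ 1 →
      ∃ (N : ℕ) (_ : NeZero N) (f : CuspForm (CongruenceSubgroup.Gamma0 N) 2) (ϖ : ℚ) (Lsharp Lflat : IwasawaAlgebra p)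
        (c : Chroma) (ξ : IwasawaAlgebra p), IsNewformOf W f ∧ (ϖ : ℝ) * W.realPeriodRat = plusPeriod f ∧
        IsSprungPair f p (W.frobeniusTrace p) Lsharp Lflat ∧ (⟨ξ, 0, 0⟩ : SignedDatum W p).EulerCharacteristic ∧
        ∃ h : IwasawaAlgebra p, iwasawaToPowerSeries p ξ =
          PowerSeries.C (ϖ : ℚ_[p]) * iwasawaToPowerSeries p (chromaticL c Lsharp Lflat * h) := by
  intro W _ _ p _ hX hr
  rcases Nat.le_one_iff_eq_zero_or_eq_one.mp hr with h0 | h1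
  · exact sprungLowerHalfAtThree_analyticRank_eq_zero_of_lowerDivisibility hK1z hK3 hS4 W p hX h0
  · -- `r_an = 1`: positive corank, the datum `ξ = h = 0`; the real objects `(f, ϖ, L♯, L♭)` as in §1
    have hp3 : p = 3 := hX.1
    subst hp3
    have hp2 : (3 : ℕ) ≠ 2 := by decide
    have hgood : W.HasGoodReductionAtPrime 3 := hX.2.1.1
    have hdvd : ((3 : ℕ) : ℤ) ∣ W.frobeniusTrace 3 := hX.2.1.2
    obtain ⟨⟨N, hN, f, hf⟩, -⟩ := hS4 W 3 hX
    haveI := hN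
    haveI : (W.baseChange ℂ).IsElliptic := by rw [WeierstrassCurve.baseChange]; infer_instance
    obtain ⟨Lat, hLat⟩ := exists_isNeronLatticeOf_holds (W.baseChange ℂ)
    obtain ⟨cM, hcM0, hcM⟩ := IsNewformOf.exists_maninConstant_ne_zero_holds hf hLat
    obtain ⟨Dm, hDf, -, -⟩ := ModularParametrizationData.exists_of_isNewformOf hf hLat hcM0 hcM
    obtain ⟨ϖ, -, hϖ', -⟩ := Dm.exists_rat_mul_realPeriodRat_eq_plusPeriod
    have hϖ : (ϖ : ℝ) * W.realPeriodRat = plusPeriod f := by rw [hϖ', hDf]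
    obtain ⟨Lsharp, Lflat, hSP⟩ :=
      thm112_exists_isSprungPair_holds (W := W) (f := f) (p := 3) hp2 hf hgood hdvd
    have hSel : ¬ Finite (W.selmerGroupPInfty 3) :=
      ChromaticCommonZerosControlAtT.not_finite_selmerGroupPInfty_of_analyticRank_eq_one hGZK W 3 h1
    obtain ⟨ξ, hK, hdiv⟩ := chromaticDatum_of_not_finite_selmer W 3 hSel ϖ (chromaticL .flat Lsharp Lflat)
    exact ⟨N, hN, f, ϖ, Lsharp, Lflat, .flat, ξ, hf, hϖ, hSP, hK, hdiv⟩


end Summit.BirchSwinnertonDyer.BirchSwinnertonDyer.Theorems.ChromaticCommonZeros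

end
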